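import Summits.CriticalPhenomena.PercolationContinuityZ3.Theorems.Transplant.SkelPhiCorridorKGYRoute
import HarnessLib

/-!
# N2 (frames-only node `SamePDropOfSkeletonFrm₁`, OPEN), (R)/(C) junction ((R-26)): **THE PER-STEP PER-CENTRE INPUT OF THE K-G CORRIDORS OF RECORD,
# PLAIN-WINDOW LAW** — `hrouteSW_kgCorr` / `hrouteSW_kgCorrY`: the `hrouteS` hypothesis of `hkits_schedF` (SkelPhiCorridorStepsF) for
# `kgCorrSched` (first axis) and `kgCorrSchedY` (second axis), from the long links at every centre, under a sub-box law `W'` of the PLAIN windows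
# `Win ψ w₀ (region k) R` (`winGraph G w₀ R`) — for the root legs of (R-26) (chains in `winGraph G c Rπ` under `W0pin`); the habitat versions are
# `hrouteS_kgCorr(Y)` (SkelPhiCorridorKGRoute / KGYRoute).
builds on p205010 (kernel theorem, internal audit signed; external expert review pending) — nothing in this file uses p205010; nothing here is a
claim about the open node `SamePDropOfSkeletonFrm₁`.
Lane `prim-bschramm`, seat `prim-bschramm-p5` (gen 15; (C) lineage, typed for the (R) column); helper file (`--supports stmt-CriticalPhenomena-4575 --as helper`).
[cite: KozmaNitzan2024, §4 Lemma 10 Step IV (pp. 20–21), Lemma 11 (pp. 22–23), Lemma 12 (pp. 23–25)] [cite: MartineauTassion2017, §4.3 Lemma 4.2]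
-/

noncomputable section

open scoped Classical

namespace Summit.CriticalPhenomena.PercolationContinuityZ3.Theorems.Transplant

namespace Skelφ

open MeasureTheory
open Literature.Probability.Percolation Literature.Probability.LatticeModels SimpleGraph KNLevels
open Literature.Barriers.CriticalPhenomena (graphBall graphBall_mono)
open Skel (winGraph winGraph_le winGraphIn winGraphIn_le)
open Literature.Probability.Percolation.KozmaNitzan.Cells (oth)
open ChainPlanar ChainPara

variable {V : Type} [DecidableEq V] [Countable V] {G : SimpleGraph V} [G.LocallyFinite] {φ : V → Site 2}

section KGX

variable {n ℓ : ℕ} {h v : ℤ} {R' ρ q W N m₁ Wm₂ Wp₂ m₂ : ℕ}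
  (hP₁ : ParkOK (kgPark₁ n ℓ h v R' ρ q W N m₁)) (hP₂ : ParkOK (kgPark₂ n ℓ h v R' ρ q W N m₁ Wm₂ Wp₂ m₂))
  (hsplit : (Wm₂ : ℤ) + Wp₂ = (kgPark₁ n ℓ h v R' ρ q W N m₁).aHi (m₁ + 1) - ParkPrm.aLo (kgPark₁ n ℓ h v R' ρ q W N m₁) (m₁ + 1))

/-- **THE PER-STEP PER-CENTRE PARKED-OR-ROUTED INPUT OF THE K-G CORRIDOR OF RECORD, PLAIN WINDOW** (`hrouteS` of `hkits_schedF` at `S := kgCorrSched …`): from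
the long x-links (side halves, both transverse signs) and the long y′-links (top pieces, both signs) at every centre at accuracy `δ³`, the window-in-
habitat row and a sub-box law on every region window. [cite: KozmaNitzan2024, §4 Lemma 10 Step IV, Lemma 12] [cite: MartineauTassion2017, §4.3 Lemma 4.2] -/
theorem hrouteSW_kgCorr (hn : 1 ≤ n) (c₀ : V) {σ : ℤ} (hσ : σ = 1 ∨ σ = -1) {w₀ : V} {R r Rl : ℕ} (hr : Rl ≤ r) (hrR : r ≤ R)
    (Rim : ℕ → Finset V) {q' : unitInterval} {W' : Sym2 V → unitInterval}
    (hWD : ∀ k ≤ (kgCorrSched hP₁ hP₂ hsplit).N, IsSubbox (winGraph G w₀ R) W' q' (Win G (runX φ c₀ n h σ) w₀ ((kgCorrSched hP₁ hP₂ hsplit).region k) R))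
    (Λc : V → ℕ → Finset V) (kz : ℕ) {δ : ℝ}
    (hlong : ∀ c (τ : ℤ), τ = 1 ∨ τ = -1 → 1 - δ ^ 3 < (bondPercolation G q').real
      (linkIn (pgramPrism G φ c n h (3 * ℓ) Rl) (Λc c kz) (pgSideHalfW G φ c n h ℓ Rl σ (σ * τ))))
    (hlongY : ∀ c (τ : ℤ), τ = 1 ∨ τ = -1 → 1 - δ ^ 3 < (bondPercolation G q').real
      (linkIn (pgramPrism G φ c n h (3 * ℓ) Rl) (Λc c kz) (pgTopPieceW G φ c n h ℓ Rl σ τ v))) :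
    ∀ k ≤ (kgCorrSched hP₁ hP₂ hsplit).N, ∀ c : V,
      runX φ c₀ n h σ c ∈ Finset.Icc ((kgCorrSched hP₁ hP₂ hsplit).lo k - (((kgCorrSched hP₁ hP₂ hsplit).R' : ℕ) : Site 2))
        ((kgCorrSched hP₁ hP₂ hsplit).hi k + (((kgCorrSched hP₁ hP₂ hsplit).R' : ℕ) : Site 2)) → c ∈ graphBall G w₀ (R - r) →
      c ∈ Win G (runX φ c₀ n h σ) w₀ (ScheduleNP.core (kgCorrSched hP₁ hP₂ hsplit) (k + 1)) R ∪ Rim k ∨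
      ∃ Qt Ft : Finset V, Ft ⊆ Win G (runX φ c₀ n h σ) w₀ (ScheduleNP.core (kgCorrSched hP₁ hP₂ hsplit) (k + 1)) R ∪ Rim k ∧
        Qt ⊆ Win G (runX φ c₀ n h σ) w₀ ((kgCorrSched hP₁ hP₂ hsplit).region k) R ∧
        1 - δ ^ 3 ≤ (prodBernoulli W').real (linkIn (↑Qt : Set V) (Λc c kz) Ft) := by
  set S := kgCorrSched hP₁ hP₂ hsplit with hS
  set ψ := runX φ c₀ n h σ with hψ
  have hSN : S.N = N + 1 + m₁ + 1 + m₂ := rfl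
  have hSR : S.R' = R' := rfl
  intro k hk c hc hcw
  -- transport along the phase identities
  have hPDof : ∀ {Reg : Finset (Site 2)}, Reg = S.region k → Win G ψ w₀ Reg R ⊆ Win G ψ w₀ (S.region k) R := by
    intro Reg hReg; rw [hReg]
  have hPTof : ∀ {Cor : Finset (Site 2)}, Cor = ScheduleNP.core S (k + 1) → Win G ψ w₀ Cor R ⊆ Win G ψ w₀ (ScheduleNP.core S (k + 1)) R ∪ Rim k := by
    intro Cor hCor; rw [hCor]; exact Finset.subset_union_left
  have hc' : ψ c ∈ ScheduleNP.level S k S.R' := hc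
  rcases kgCorrSched_step_cases (N := N) (m₁ := m₁) (m₂ := m₂) (k := k) (hk.trans_eq hSN) with hkN | ⟨j, hj, rfl⟩ | ⟨j, hj, rfl⟩
  · -- run phase
    obtain ⟨hreg, hlev, -⟩ := kgCorrSched_run_view hP₁ hP₂ hsplit hkN
    have hcs := kgCorrSched_core_succ_run hP₁ hP₂ hsplit hkN
    rw [hlev] at hc'
    exact hroute_runB (φ := φ) hn c₀ hσ (k := k) hr hrR (hPDof hreg.symm) (hPTof hcs.symm) (hWD k hk) Λc kz hlong c hc' hcw
  · -- across-parking phase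
    obtain ⟨hreg, hlev, -⟩ := kgCorrSched_park₁_view hP₁ hP₂ hsplit hj
    have hcs := kgCorrSched_core_succ_park₁ hP₁ hP₂ hsplit hj
    rw [hlev] at hc'
    exact hroute_yParkC (φ := φ) hP₁ (kgC₁ n N) hn c₀ hσ (k := j) hr hrR (hPDof hreg.symm) (hPTof hcs.symm) (hWD _ hk) Λc kz hlongY
      c hc' hcw
  · -- along-parking phase
    obtain ⟨hreg, hlev, -⟩ := kgCorrSched_park₂_view hP₁ hP₂ hsplit j
    have hcs := kgCorrSched_core_succ_park₂ hP₁ hP₂ hsplit j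
    rw [hlev] at hc'
    exact hroute_xParkC (φ := φ) hP₂ (kgC₂ n ℓ h v R' ρ q W N m₁ Wp₂) hn c₀ hσ (k := j) hr hrR (hPDof hreg.symm) (hPTof hcs.symm)
      (hWD _ hk) Λc kz hlong c hc' hcw

end KGX

section KGYsec

variable {n ℓ : ℕ} {h v : ℤ} {R' ρ q W N m₁ Wm₂ Wp₂ m₂ : ℕ} (hn : 1 ≤ n) (hv : |v| ≤ n) (hlay : (n + h.natAbs : ℕ) ≤ (n : ℤ) * ℓ + 1)
  (hP₁ : ParkOK (kgPark₁Y n ℓ h v R' ρ q W N m₁)) (hP₂ : ParkOK (kgPark₂Y n ℓ h v R' ρ q W N m₁ Wm₂ Wp₂ m₂))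
  (hsplit : (Wm₂ : ℤ) + Wp₂ = (kgPark₁Y n ℓ h v R' ρ q W N m₁).aHi (m₁ + 1) - ParkPrm.aLo (kgPark₁Y n ℓ h v R' ρ q W N m₁) (m₁ + 1))

/-- **THE PER-STEP PER-CENTRE PARKED-OR-ROUTED INPUT OF THE SECOND-AXIS K-G CORRIDOR OF RECORD** , PLAIN WINDOW (`hrouteS` of `hkits_schedF` at `S := kgCorrSchedY …`): from
the long x-links (side halves, both transverse signs) and the long y′-links (top pieces, both signs) at every centre at accuracy `δ³`, the window-in-
habitat row and a sub-box law on every region window. [cite: KozmaNitzan2024, §4 Lemma 10 Step IV, Lemma 12] [cite: MartineauTassion2017, §4.3 Lemma 4.2] -/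
theorem hrouteSW_kgCorrY (c₀ : V) {σ : ℤ} (hσ : σ = 1 ∨ σ = -1) {w₀ : V} {R r Rl : ℕ} (hr : Rl ≤ r) (hrR : r ≤ R)
    (Rim : ℕ → Finset V) {q' : unitInterval} {W' : Sym2 V → unitInterval}
    (hWD : ∀ k ≤ (kgCorrSchedY hn hv hlay hP₁ hP₂ hsplit).N, IsSubbox (winGraph G w₀ R) W' q' (Win G (runX φ c₀ n h σ) w₀ ((kgCorrSchedY hn hv hlay hP₁ hP₂ hsplit).region k) R))
    (Λc : V → ℕ → Finset V) (kz : ℕ) {δ : ℝ}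
    (hlong : ∀ c (τ : ℤ), τ = 1 ∨ τ = -1 → 1 - δ ^ 3 < (bondPercolation G q').real
      (linkIn (pgramPrism G φ c n h (3 * ℓ) Rl) (Λc c kz) (pgSideHalfW G φ c n h ℓ Rl σ (σ * τ))))
    (hlongY : ∀ c (τ : ℤ), τ = 1 ∨ τ = -1 → 1 - δ ^ 3 < (bondPercolation G q').real
      (linkIn (pgramPrism G φ c n h (3 * ℓ) Rl) (Λc c kz) (pgTopPieceW G φ c n h ℓ Rl σ τ v))) :
    ∀ k ≤ (kgCorrSchedY hn hv hlay hP₁ hP₂ hsplit).N, ∀ c : V,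
      runX φ c₀ n h σ c ∈ Finset.Icc ((kgCorrSchedY hn hv hlay hP₁ hP₂ hsplit).lo k - (((kgCorrSchedY hn hv hlay hP₁ hP₂ hsplit).R' : ℕ) : Site 2))
        ((kgCorrSchedY hn hv hlay hP₁ hP₂ hsplit).hi k + (((kgCorrSchedY hn hv hlay hP₁ hP₂ hsplit).R' : ℕ) : Site 2)) → c ∈ graphBall G w₀ (R - r) →
      c ∈ Win G (runX φ c₀ n h σ) w₀ (ScheduleNP.core (kgCorrSchedY hn hv hlay hP₁ hP₂ hsplit) (k + 1)) R ∪ Rim k ∨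
      ∃ Qt Ft : Finset V, Ft ⊆ Win G (runX φ c₀ n h σ) w₀ (ScheduleNP.core (kgCorrSchedY hn hv hlay hP₁ hP₂ hsplit) (k + 1)) R ∪ Rim k ∧
        Qt ⊆ Win G (runX φ c₀ n h σ) w₀ ((kgCorrSchedY hn hv hlay hP₁ hP₂ hsplit).region k) R ∧
        1 - δ ^ 3 ≤ (prodBernoulli W').real (linkIn (↑Qt : Set V) (Λc c kz) Ft) := by
  set S := kgCorrSchedY hn hv hlay hP₁ hP₂ hsplit with hS
  set ψ := runX φ c₀ n h σ with hψ
  have hSN : S.N = N + 1 + m₁ + 1 + m₂ := rfl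
  have hSR : S.R' = R' := rfl
  intro k hk c hc hcw
  -- transport along the phase identities
  have hPDof : ∀ {Reg : Finset (Site 2)}, Reg = S.region k → Win G ψ w₀ Reg R ⊆ Win G ψ w₀ (S.region k) R := by
    intro Reg hReg; rw [hReg]
  have hPTof : ∀ {Cor : Finset (Site 2)}, Cor = ScheduleNP.core S (k + 1) → Win G ψ w₀ Cor R ⊆ Win G ψ w₀ (ScheduleNP.core S (k + 1)) R ∪ Rim k := by
    intro Cor hCor; rw [hCor]; exact Finset.subset_union_left
  have hc' : ψ c ∈ ScheduleNP.level S k S.R' := hc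
  rcases kgCorrSched_step_cases (N := N) (m₁ := m₁) (m₂ := m₂) (k := k) (hk.trans_eq hSN) with hkN | ⟨j, hj, rfl⟩ | ⟨j, hj, rfl⟩
  · -- y′-run phase
    obtain ⟨hreg, hlev, -⟩ := kgCorrSchedY_run_view hn hv hlay hP₁ hP₂ hsplit hkN
    have hcs := kgCorrSchedY_core_succ_run hn hv hlay hP₁ hP₂ hsplit hkN
    rw [hlev] at hc'
    exact hroute_yRunB (φ := φ) hn hv hlay R' q W N c₀ hσ (k := k) hr hrR (hPDof hreg.symm) (hPTof hcs.symm) (hWD k hk) Λc kz hlongY c hc' hcw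
  · -- across-parking phase
    obtain ⟨hreg, hlev, -⟩ := kgCorrSchedY_park₁_view hn hv hlay hP₁ hP₂ hsplit hj
    have hcs := kgCorrSchedY_core_succ_park₁ hn hv hlay hP₁ hP₂ hsplit hj
    rw [hlev] at hc'
    exact hroute_xParkC (φ := φ) hP₁ (kgC₁Y n ℓ h v N) hn c₀ hσ (k := j) hr hrR (hPDof hreg.symm) (hPTof hcs.symm) (hWD _ hk) Λc kz hlong
      c hc' hcw
  · -- along-parking phase
    obtain ⟨hreg, hlev, -⟩ := kgCorrSchedY_park₂_view hn hv hlay hP₁ hP₂ hsplit j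
    have hcs := kgCorrSchedY_core_succ_park₂ hn hv hlay hP₁ hP₂ hsplit j
    rw [hlev] at hc'
    exact hroute_yParkC (φ := φ) hP₂ (kgC₂Y n ℓ h v R' ρ q W N m₁ Wp₂) hn c₀ hσ (k := j) hr hrR (hPDof hreg.symm) (hPTof hcs.symm)
      (hWD _ hk) Λc kz hlongY c hc' hcw

end KGYsec

end Skelφ

end Summit.CriticalPhenomena.PercolationContinuityZ3.Theorems.Transplant

end
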